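import Summits.NavierStokesRegularity.FluidComputer.GateBudgetLadderFine
import HarnessLib

/-!
# What no tuning can beat, part 69: THE FINE DUD HORIZON — the two budgets of part 67's fine
# misfire ladder discharged in closed form: the headline member's output gate obeys `ã ≤ 0.1415`
# on `[0, 1.8282 + K⁹/(200(k + 100 log K))]`, i.e. Tao's delay machine started from `delayInit`
# does not fire before time `≈ 5·10⁻⁵K⁹/log K` at every fixed lattice index `k` (`1.2·10⁶` at
# `K = 16`, `1.1·10¹³` at `K = 100`) (SPEC-INPUT-bp1 §AW/§BE)

Cell `pub-fluidc`, blueprint seat bp1 (gen 35, seventh item, file 2 of 2); same namespace and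
conventions as parts 1–68 (`GateBudget*.lean`); imports part 67 (`GateBudgetLadderFine`: §210
`knob_ladder_no_output_fine`; through it part 63 §196 `rung_numerics`); independent of part 68
(the coarse twin, horizon `K⁹/(200k + 80000K)`).
Headline knob family `rotorCircuit K K¹⁰ ε ρ` from (5.6) (modes `0 = a`, `1 = b` clock, `2 = c`
trigger, `3 = d`, `4 = ã` output), a trigger primitive `C` (`C' = c`), the lattice `ε = kK¹⁰ρ²`
on the window `200ε/K²⁰ ≤ ρ² ≤ 2ε/K¹⁰`, `δ₀ = kπ/((25/16 - 10⁻⁶)K¹⁰ - 1) + 1/K¹⁹`. HONEST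
FRAMING (verbatim): low prior, high value-of-information experiment on Tao's machine paradigm;
NOT a claim that NS blows up. Nothing is proved about the Navier–Stokes equations.

## Why (SPEC-INPUT-bp1 §AW/§BE: one quotable statement instead of two budget hypotheses)

Part 67 §210 `knob_ladder_no_output_fine` carries its budgets as hypotheses on a natural number
`N`: the clock budget `(N - 1)·286/K⁹ ≤ 0.144` and the pair budget `0.00806 + N·s′ ≤ 1/50` with
the FINE increment `s′ = 0.3(δ₀ + 310 log K/K⁹) + 6/K⁹` (law 3′, parts 65–67). This file chooses
`N := ⌊x⌋₊ + 1`, `x := K⁹/(200(k + 100 log K))`, and verifies both by elementary estimates: the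
identity `200·xk + 20000·x log K = K⁹` with `log K ≥ 2` gives `xk ≤ K⁹/200`,
`x log K ≤ K⁹/20000` and `x ≤ K⁹/40000`; with `D := (25/16 - 10⁻⁶)K¹⁰ - 1 ≥ K¹⁰ ≥ 16K⁹` and
`π < 3.15` this yields `x·kπ/D ≤ 10⁻³`, `x/K¹⁹ ≤ x/K⁹ ≤ 1/40000`, `310·x log K/K⁹ ≤ 0.0155`,
`6x/K⁹ ≤ 0.00015`, hence `x·s′ ≤ 0.0052`; `310 log K/K⁹ ≤ 1210/K⁸` (`log K ≤ K`) and part 63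
§196 give `s′ ≤ 0.3·0.0171 + 6/K⁹ ≤ 0.005131`; so `0.00806 + (x + 1)s′ ≤ 0.0184 ≤ 1/50`, and
`⌊x⌋₊·286/K⁹ ≤ 286x/K⁹ ≤ 0.00715`.

## What is proved

* §213 `horizon_numerics_fine`: `0 ≤ x`, `x ≤ ⌊x⌋₊ + 1`, and both budgets of part 67 §210 at
  `N := ⌊x⌋₊ + 1` (stated with the cast `((⌊x⌋₊ + 1 : ℕ) : ℝ)` exactly as §210 consumes them).
* §214 `knob_dud_horizon_fine` (THE FINE DUD HORIZON): for the headline member from `delayInit`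
  with a trigger primitive, `K ≥ 16`, `0 < ε`, `ε² ≤ 1/(6K²⁰)`, `0 < ρ`, `200ε/K²⁰ ≤ ρ²`,
  `K¹⁰ρ² ≤ 2ε`, `ε = kK¹⁰ρ²`: `∀ t ∈ [0, 1.8282 + K⁹/(200(k + 100 log K))]`, `ã(t) ≤ 0.1415`.

HONEST LIMITS. (i) `K⁹/(200(k + 100 log K))` is a convenient UNDER-estimate of part 67's
budget `N ≤ 0.01194/s′` (`≈ 1.3·10⁻⁴K⁹/log K` at small `k`; the closed form keeps `≈ 40 %` of
it); at the top of the lattice window (`k ≍ K¹⁰/200`) it is `< 1` and the statement says no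
more than part 49 (`N = 1`, horizon `< 2.83`); it is `≈ 4K/log K` times the coarse horizon of
part 68 at small `k` and the two agree in order once `k ≫ K`; (ii) every limit of part 67 stands
(headline family `M = K¹⁰`, `K ≥ 16`, lattice `ε = kK¹⁰ρ²` only; anchor `P₁ ≤ 0.00806` from part
49; the logarithm is the dousing time `241 log K/K¹⁰` of part 65 and is NOT removable by this
method); (iii) it is NOT a statement that the machine never fires — nothing is claimed after the
horizon; (iv) nothing about Navier–Stokes.
[cite: Tao2016AveragedNS, §5.5 Theorem 5.3, (5.5), (5.6), (b-eq), (c-eq), (ta-eq), (energy-con)]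
-/

noncomputable section

namespace Summit.NavierStokesRegularity.FluidComputer.GateBudget

open Real Set
open Literature.Analysis.FluidPDE.Tao2016AveragedNS

variable {K ε ρ : ℝ} {X : ℝ → Fin 5 → ℝ}

/-! ## §213 Fine horizon numerics -/

/-- §213 FINE HORIZON NUMERICS. `K ≥ 16`, `0 < ε`, `0 < ρ`, `200ε/K²⁰ ≤ ρ²`, `ε = kK¹⁰ρ²`,
`x = K⁹/(200(k + 100 log K))` ⇒ `0 ≤ x`, `x ≤ ⌊x⌋₊ + 1`, the clock budget
`(⌊x⌋₊ + 1 - 1)·286/K⁹ ≤ 0.144` and the pair budget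
`0.00806 + (⌊x⌋₊ + 1)·(0.3(δ₀ + 310 log K/K⁹) + 6/K⁹) ≤ 1/50` of part 67 §210.
[derived: part 63 §196 `rung_numerics`, part 9 `headline_pow_floor`, `Real.exp_one_lt_d9`,
`Real.log_le_sub_one_of_pos`, `Nat.floor_le`, `Nat.lt_floor_add_one`, `Real.pi_lt_d2`] -/
theorem horizon_numerics_fine (hK : 16 ≤ K) (hε : 0 < ε) (hρ : 0 < ρ)
    (hlo : 200 * ε / K ^ 20 ≤ ρ ^ 2) (k : ℕ) (hk : ε = k * K ^ 10 * ρ ^ 2) {x : ℝ}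
    (hx : x = K ^ 9 / (200 * (k + 100 * log K))) :
    0 ≤ x ∧ x ≤ ((⌊x⌋₊ + 1 : ℕ) : ℝ) ∧
      (((⌊x⌋₊ + 1 : ℕ) : ℝ) - 1) * (286 / K ^ 9) ≤ 144 / 1000 ∧
      806 / 100000 + ((⌊x⌋₊ + 1 : ℕ) : ℝ) * (3 * (k * π / ((25 / 16 - 1 / 10 ^ 6) * K ^ 10
        - 1) + 1 / K ^ 19 + 310 * log K / K ^ 9) / 10 + 6 / K ^ 9) ≤ 1 / 50 := by
  obtain ⟨-, -, hD0, hδ0, hη, -⟩ := rung_numerics hK hε hρ hlo k hk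
  have hK0 : (0 : ℝ) < K := by linarith
  have hK1 : (1 : ℝ) ≤ K := by linarith
  have hK8 : (0 : ℝ) < K ^ 8 := by positivity
  have hK9 : (0 : ℝ) < K ^ 9 := by positivity
  have hk0 : (0 : ℝ) ≤ k := Nat.cast_nonneg k
  obtain ⟨D, hD_def⟩ : ∃ D : ℝ, D = (25 / 16 - 1 / 10 ^ 6) * K ^ 10 - 1 := ⟨_, rfl⟩
  simp only [← hD_def] at hD0 hδ0 hη ⊢
  -- `2 ≤ log K ≤ K`: `e < 2.72`, so `e² < 7.4 ≤ K`
  have hlog2 : (2 : ℝ) ≤ log K := by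
    have h1 : exp (2 : ℝ) = exp 1 ^ 2 := by
      rw [← Real.exp_nat_mul]; norm_num
    have h2 := Real.exp_one_lt_d9
    have h3 : 0 < exp (1 : ℝ) := Real.exp_pos 1
    have hexp2 : exp (2 : ℝ) ≤ K := by rw [h1]; nlinarith [h2, h3, hK]
    have h4 : log (exp 2) ≤ log K := Real.log_le_log (Real.exp_pos 2) hexp2
    rwa [Real.log_exp] at h4
  have hlog0 : (0 : ℝ) ≤ log K := by linarith only [hlog2]
  have hlogK : log K ≤ K := by linarith only [Real.log_le_sub_one_of_pos hK0]
  -- the defining identity of `x` and its linear consequences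
  have hA0 : (0 : ℝ) < 200 * (k + 100 * log K) := by linarith only [hk0, hlog2]
  have hx0 : 0 ≤ x := by rw [hx]; exact div_nonneg hK9.le hA0.le
  have hxA : 200 * (x * k) + 20000 * (x * log K) = K ^ 9 := by
    have e : x * (200 * (k + 100 * log K)) = K ^ 9 := by
      rw [hx]; exact div_mul_cancel₀ _ hA0.ne'
    rw [← e]; ring
  have hxk0 : 0 ≤ x * k := mul_nonneg hx0 hk0
  have hxl0 : 0 ≤ x * log K := mul_nonneg hx0 hlog0
  have hxk : x * k ≤ K ^ 9 / 200 := by linarith only [hxA, hxl0]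
  have hxl : x * log K ≤ K ^ 9 / 20000 := by linarith only [hxA, hxk0]
  have hxle : x ≤ K ^ 9 / 40000 := by
    have h2x : x * 2 ≤ x * log K := mul_le_mul_of_nonneg_left hlog2 hx0
    linarith only [h2x, hxl]
  have hq9 : K ^ 9 / 40000 * (1 / K ^ 9) = 1 / 40000 := by
    rw [div_mul_div_comm, div_eq_div_iff (by positivity) (by norm_num)]; ring
  have hq9' : K ^ 9 / 20000 * (1 / K ^ 9) = 1 / 20000 := by
    rw [div_mul_div_comm, div_eq_div_iff (by positivity) (by norm_num)]; ring
  have hx9 : x * (1 / K ^ 9) ≤ 1 / 40000 :=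
    (mul_le_mul_of_nonneg_right hxle (by positivity)).trans hq9.le
  have hxl9 : x * log K * (1 / K ^ 9) ≤ 1 / 20000 :=
    (mul_le_mul_of_nonneg_right hxl (by positivity)).trans hq9'.le
  -- floor facts and the cast of `⌊x⌋₊ + 1`
  have hfl : (⌊x⌋₊ : ℝ) ≤ x := Nat.floor_le hx0
  have hfl' : x < (⌊x⌋₊ : ℝ) + 1 := Nat.lt_floor_add_one x
  have hcast : ((⌊x⌋₊ + 1 : ℕ) : ℝ) = (⌊x⌋₊ : ℝ) + 1 := by push_cast; ring
  rw [hcast]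
  -- the four products `x·(term)`
  have hpow19 : K ^ 9 ≤ K ^ 19 := pow_le_pow_right₀ hK1 (by norm_num)
  have h19 : 1 / K ^ 19 ≤ 1 / K ^ 9 := one_div_le_one_div_of_le hK9 hpow19
  have hDK : K ^ 10 ≤ D := by
    have h2 : (16 : ℝ) ^ 10 ≤ K ^ 10 := headline_pow_floor hK 10
    rw [hD_def]; linarith [h2]
  have hK10 : 16 * K ^ 9 ≤ K ^ 10 := by
    have e : K ^ 10 = K * K ^ 9 := by ring
    rw [e]; exact mul_le_mul_of_nonneg_right hK hK9.le
  have hT1 : x * (k * π / D) ≤ 1 / 1000 := by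
    have e : x * (k * π / D) = x * k * π / D := by ring
    rw [e, div_le_iff₀ hD0]
    have h1 : x * k * π ≤ K ^ 9 / 200 * 3.15 :=
      mul_le_mul hxk Real.pi_lt_d2.le Real.pi_pos.le (by positivity)
    linarith [h1, hDK, hK10]
  have hT2 : x * (1 / K ^ 19) ≤ 1 / 40000 := (mul_le_mul_of_nonneg_left h19 hx0).trans hx9
  have hT3 : x * (310 * log K / K ^ 9) ≤ 310 / 20000 := by
    have e : x * (310 * log K / K ^ 9) = 310 * (x * log K * (1 / K ^ 9)) := by ring
    rw [e]; linarith only [hxl9]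
  have hT4 : x * (6 / K ^ 9) ≤ 6 / 40000 := by
    have e : x * (6 / K ^ 9) = 6 * (x * (1 / K ^ 9)) := by ring
    rw [e]; linarith only [hx9]
  -- the increment `s′` itself: `310 log K/K⁹ ≤ 1210/K⁸`, `s′ ≤ 0.3·0.0171 + 6/K⁹ ≤ 0.005131`
  have h310 : 310 * log K / K ^ 9 ≤ 1210 / K ^ 8 :=
    calc 310 * log K / K ^ 9 ≤ 310 * K / K ^ 9 :=
          div_le_div_of_nonneg_right (by linarith only [hlogK]) hK9.le
      _ = 310 / K ^ 8 := by rw [div_eq_div_iff (by positivity) (by positivity)]; ring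
      _ ≤ 1210 / K ^ 8 := div_le_div_of_nonneg_right (by norm_num) hK8.le
  have h310_0 : (0 : ℝ) ≤ 310 * log K / K ^ 9 :=
    div_nonneg (mul_nonneg (by norm_num) hlog0) hK9.le
  have h6K : 6 / K ^ 9 ≤ 1 / 10 ^ 9 :=
    (div_le_div_of_nonneg_left (by norm_num) (by positivity)
      (headline_pow_floor hK 9)).trans (by norm_num)
  have h6K0 : (0 : ℝ) ≤ 6 / K ^ 9 := by positivity
  obtain ⟨S, hS_def⟩ : ∃ S : ℝ, S = 3 * (k * π / D + 1 / K ^ 19 + 310 * log K / K ^ 9) / 10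
      + 6 / K ^ 9 := ⟨_, rfl⟩
  have hS0 : 0 ≤ S := by rw [hS_def]; linarith only [hδ0, h310_0, h6K0]
  have hSle : S ≤ 5131 / 1000000 := by rw [hS_def]; linarith only [hη, h310, h6K]
  have hxS : x * S ≤ 13 / 2500 := by
    have e : x * S = 3 / 10 * (x * (k * π / D)) + 3 / 10 * (x * (1 / K ^ 19))
        + 3 / 10 * (x * (310 * log K / K ^ 9)) + x * (6 / K ^ 9) := by rw [hS_def]; ring
    rw [e]; linarith only [hT1, hT2, hT3, hT4]
  simp only [← hS_def]
  refine ⟨hx0, hfl'.le, ?_, ?_⟩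
  · -- clock budget: `⌊x⌋₊·286/K⁹ ≤ x·286/K⁹ ≤ 286/40000`
    have e : ((⌊x⌋₊ : ℝ) + 1 - 1) * (286 / K ^ 9) = (⌊x⌋₊ : ℝ) * (286 / K ^ 9) := by ring
    rw [e]
    have h1 : (⌊x⌋₊ : ℝ) * (286 / K ^ 9) ≤ x * (286 / K ^ 9) :=
      mul_le_mul_of_nonneg_right hfl (by positivity)
    have e2 : x * (286 / K ^ 9) = 286 * (x * (1 / K ^ 9)) := by ring
    rw [e2] at h1; linarith only [h1, hx9]
  · -- pair budget: `(⌊x⌋₊ + 1)s′ ≤ (x + 1)s′ = xs′ + s′ ≤ 0.0052 + 0.005131`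
    have hmono : ((⌊x⌋₊ : ℝ) + 1) * S ≤ (x + 1) * S :=
      mul_le_mul_of_nonneg_right (by linarith only [hfl]) hS0
    have e : (x + 1) * S = x * S + S := by ring
    linarith only [hmono, hxS, hSle, e]

/-! ## §214 The fine dud horizon -/

/-- §214 THE FINE DUD HORIZON (part 67 §210 with its budgets discharged). For the headline
member `X` from `delayInit` with a trigger primitive `C`, `K ≥ 16`, `0 < ε`, `ε² ≤ 1/(6K²⁰)`,
`0 < ρ`, the lattice window `200ε/K²⁰ ≤ ρ²`, `K¹⁰ρ² ≤ 2ε` and the lattice `ε = kK¹⁰ρ²`: the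
output gate obeys `ã(t) ≤ 0.1415` for all `t ∈ [0, 1.8282 + K⁹/(200(k + 100 log K))]` — the
machine does not fire before time `≈ 5·10⁻⁵K⁹/log K` at every fixed lattice index `k` (a firing
machine drives `ã` to `1`). Nothing is claimed after the horizon.
[derived: part 67 §210 `knob_ladder_no_output_fine` at `N := ⌊K⁹/(200(k + 100 log K))⌋₊ + 1`,
§213] -/
theorem knob_dud_horizon_fine
    (hX : ∀ t, HasDerivAt X (RotorKnob.rotorCircuit K (K ^ 10) ε ρ (X t)) t)
    (h0 : X 0 = delayInit) {C : ℝ → ℝ} (hC : ∀ t, HasDerivAt C (X t 2) t) (hK : 16 ≤ K)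
    (hε : 0 < ε) (hεK : ε ^ 2 ≤ 1 / (6 * K ^ 20)) (hρ : 0 < ρ)
    (hlo : 200 * ε / K ^ 20 ≤ ρ ^ 2) (hhi : K ^ 10 * ρ ^ 2 ≤ 2 * ε) (k : ℕ)
    (hk : ε = k * K ^ 10 * ρ ^ 2) :
    ∀ t ∈ Icc (0 : ℝ) (18282 / 10000 + K ^ 9 / (200 * (k + 100 * log K))),
      X t 4 ≤ 1415 / 10000 := by
  intro t ht
  obtain ⟨-, hxN, hNθ, hNP⟩ :=
    horizon_numerics_fine hK hε hρ hlo k hk (x := K ^ 9 / (200 * (k + 100 * log K))) rfl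
  exact knob_ladder_no_output_fine hX h0 hC hK hε hεK hρ hlo hhi k hk
    (⌊K ^ 9 / (200 * (k + 100 * log K))⌋₊ + 1) (Nat.le_add_left 1 _) hNθ hNP t
    ⟨ht.1, by linarith only [ht.2, hxN]⟩

end Summit.NavierStokesRegularity.FluidComputer.GateBudget

end
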